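import Literature.Probability.RandomPlanarGeometry.HexSAWSurfaceWallDensityPinch
import Literature.Probability.RandomPlanarGeometry.HexSAWSurfaceWallDensityCoefficient
import Literature.Probability.RandomPlanarGeometry.HexSAWSurfaceWallDensitySecondTerm
import HarnessLib

/-!
# The renewal excess of the adsorbed phase to exact order: `2/y² ≲ m(y) − 1 ≲ 4/y²`, log-free and Kendall-free

Topic `Literature/Probability/RandomPlanarGeometry` (lane «pcv-sawmu», a-idea-1 g30, car «EXCESS-ORDER»; parents: POOL
`HexSAWSurfaceWallDensityPinch.lean` («DENSITY-PINCH», a-idea-1 g30 car 55: at every `t` with `eᵗ > μ⁴` the DEFICIT WINDOW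
`(m − 1)/(4m) ≤ ½ − ρ⁻(t)` (`le_half_sub_wallLeftDensity`) and `½ − ρ⁺(t) ≤ (m − 1)/(2m)` (`half_sub_wallRightDensity_le`),
`m = pwbMean (eᵗ)` the mean block half-length of Kesten's renewal decomposition of adsorbed wall bridges, `ρ^±` the one-sided
densities of adsorbed vertices = one-sided derivatives of the convex free energy `κ(t) = log β(eᵗ)` of the tree frame
`HexSAWSurfaceWallDensity.lean`) and the TREE's density asymptotics of the sibling lane, `HexSAWSurfaceWallDensityCoefficient.lean`
(`t ≥ log 163`: `e^{−2t} − 21874 e^{−5t/2} ≤ ½ − ρ⁺(t)`, `½ − ρ⁻(t) ≤ e^{−2t} + 52492 e^{−5t/2}`, `e^{2t}(½ − ρ^±(t)) → 1`) and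
`HexSAWSurfaceWallDensitySecondTerm.lean` (`t ≥ log 200`: `e^{−2t} + (3/2)e^{−3t} − 950003 e^{−7t/2} ≤ ½ − ρ⁺(t)`,
`½ − ρ⁻(t) ≤ e^{−2t} + (3/2)e^{−3t} + 4275004 e^{−7t/2}`)).

THE POINT (lens «bridge / renewal decompositions WITH EXPLICIT RATES»: which statements about the renewal structure become
provable with an explicit rate once a finite-data-certified inequality is in hand).  The deficit window of «DENSITY-PINCH» reads
the density deficit `½ − ρ` as the relative renewal excess `(m − 1)/m` up to a factor between `¼` and `½`; it was derived in the
direction renewal ⟹ density.  Read BACKWARDS, the sibling lane's certified density asymptotics (finite data: the fourth-order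
coefficient windows of `β(y)²`) become statements about Kesten's renewal law:

* **§2 (t-language)** `2 m (e^{−2t} + (3/2)e^{−3t} − 950003 e^{−7t/2}) ≤ m − 1 ≤ 4 m (e^{−2t} + (3/2)e^{−3t} + 4275004 e^{−7t/2})`
  for `t ≥ log 200` (`two_terms_le_pwbMean_exp_sub_one`, `pwbMean_exp_sub_one_le_two_terms`), and the first-order pair with the
  constants `21874 / 52492` for `t ≥ log 163`;
* **§3 (y-language, numbers)** `2 m(y) (y⁻² + (3/2)y⁻³ − 950003 y⁻³/√y) ≤ m(y) − 1 ≤ 4 m(y) (y⁻² + (3/2)y⁻³ + 4275004 y⁻³/√y)`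
  for `y ≥ 200`; ★ `1/y² ≤ m(y) − 1` for `y ≥ 20000`; ★ `m(y) − 1 ≤ 5/y²` for `y ≥ 100000`;
* **§4 (asymptotic window)** ★★ for every `ε > 0`, eventually `2 − ε ≤ y² (m(y) − 1) ≤ 4 + ε` (and the same in `t` with `e^{2t}`);
  ★★ `(m(y) − 1) =Θ[atTop] (1/y²)`.

So the renewal excess is of EXACT ORDER `y⁻²`, with NO logarithm and with the asymptotic constant pinned to `[2, 4]` — compare the
lane's earlier certified bounds: `m(y) − 1 ≤ 8749 (5 + 3 log y)/y²` (`y ≥ 100`, pool «ATOMIC-LIMIT», through Kendall's renewal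
rate and the first atom), `1/(2y²) ≤ m(y) − 1` (`y ≥ 230`, pool «TWO-SIDED») and `1/(5y² + 1) ≤ m(y) − 1` (all `y > μ⁴`, pool
«EXPONENT-PINCH»).  No renewal-rate (Kendall) input is used: only Kesten's identity (inside the parents' chords), convexity of the
free energy (tree) and the sibling lane's finite-data windows.

HONEST LABEL.  LANE COROLLARY (CLASS D on car 55 → 54 → 53; the density files are tree): short real-inequality bookkeeping on top
of the parents.  NEW-IN-WRITING (modest): the order-`y⁻²` law of the mean block length of adsorbed hexagonal-lattice wall bridges
with explicit two-sided constants; the printed literature has the renewal/density dictionary for PINNING models (density of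
returns = derivative of the free energy = reciprocal mean of the tilted return law, [Hollander2009, Thm 7.3, (7.26)];
[JansevanRensburg2000, (3.17), Thm 5.55]) and the positivity of the adsorbed density ([BeatonBousquetMelouDeGierDuminilCopinGuttmann2014,
p. 10]), not this quantitative statement.  NOT CLAIMED: the existence of `lim y²(m(y) − 1)` or its value (the window `[2, 4]` is
what the factor-two slack of the deficit window allows; closing it needs the mean NUMBER OF VISITS per block to second order —
not attempted); anything at or below `μ⁴`; any statement for `y < 163`.

[cite: BeatonBousquetMelouDeGierDuminilCopinGuttmann2014, Section 3.1, Proposition 5 (arXiv v5 p. 9) and p. 10 (density of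
vertices in the surface `= y ∂log μ(y)/∂y`, positive for `y > y_c`)]
[cite: MadrasSlade1993, Section 4.2, (4.2.4) (p. 91) and Theorem 4.2.2 (pp. 91-92) (renewal equation for bridges; mean of the
irreducible-bridge law)]
[cite: Kesten1963SAW, Section 4 (irreducible bridge decomposition)]
[cite: Feller1968, XIII.3 and XIII.10 (renewal theorem; mean recurrence time)]
[cite: Hollander2009, Section 7.1, Theorem 7.3 and (7.26) (pinned polymer: free energy and density of returns through the
renewal mean)]
[cite: JansevanRensburg2000, Section 3.3, eq. (3.17) and Section 5.4, Theorem 5.55]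
-/

noncomputable section

namespace Literature.Probability.RandomPlanarGeometry.SAW.HexBW.Wall

open Finset Filter Function Asymptotics
open Literature.Probability.LatticeModels
open _root_.Topology

variable {y : ℝ} {t ε : ℝ}

/-! ### §1. Bookkeeping: the regime, and `e^{−kt}`, `e^{−kt/2}` as powers of `eᵗ` and `e^{t/2}` -/

/-- `μ⁴ < 16` (`μ < 2`, tree). [cite: DuminilCopinSmirnov2012, Theorem 1] -/
private theorem mu_four_lt_sixteen_eo : hexConnectiveConstant ^ 4 < 16 := by
  have h := pow_lt_pow_left₀ hexConnectiveConstant_lt_two hexConnectiveConstant_pos.le (by norm_num : (4 : ℕ) ≠ 0)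
  norm_num at h
  exact h

/-- In the regime `t ≥ log 163` one has `μ⁴ < eᵗ`. [cite: DuminilCopinSmirnov2012, Theorem 1] -/
private theorem mu_four_lt_exp_eo (ht : Real.log 163 ≤ t) : hexConnectiveConstant ^ 4 < Real.exp t := by
  have h163 : (163 : ℝ) ≤ Real.exp t := (Real.log_le_iff_le_exp (by norm_num)).1 ht
  linarith [mu_four_lt_sixteen_eo]

/-- `e^{−2t} = 1/(eᵗ)²`. [cite: Feller1968, XIII.3] -/
private theorem exp_neg_two_eo (t : ℝ) : Real.exp (-(2 * t)) = 1 / Real.exp t ^ 2 := by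
  rw [Real.exp_neg, show (2 : ℝ) * t = ((2 : ℕ) : ℝ) * t by norm_num, Real.exp_nat_mul, one_div]

/-- `e^{−3t} = 1/(eᵗ)³`. [cite: Feller1968, XIII.3] -/
private theorem exp_neg_three_eo (t : ℝ) : Real.exp (-(3 * t)) = 1 / Real.exp t ^ 3 := by
  rw [Real.exp_neg, show (3 : ℝ) * t = ((3 : ℕ) : ℝ) * t by norm_num, Real.exp_nat_mul, one_div]

/-- `(e^{t/2})² = eᵗ`. [cite: Feller1968, XIII.3] -/
private theorem exp_half_sq_eo (t : ℝ) : Real.exp (t / 2) ^ 2 = Real.exp t := by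
  rw [sq, ← Real.exp_add]; ring_nf

/-- `e^{−5t/2} = 1/((eᵗ)² e^{t/2})`. [cite: Feller1968, XIII.3] -/
private theorem exp_neg_five_halves_eo (t : ℝ) : Real.exp (-(5 * t / 2)) = 1 / (Real.exp t ^ 2 * Real.exp (t / 2)) := by
  rw [Real.exp_neg, show (5 : ℝ) * t / 2 = ((2 : ℕ) : ℝ) * t + t / 2 by push_cast; ring, Real.exp_add, Real.exp_nat_mul,
    one_div]

/-- `e^{−7t/2} = 1/((eᵗ)³ e^{t/2})`. [cite: Feller1968, XIII.3] -/
private theorem exp_neg_seven_halves_eo (t : ℝ) : Real.exp (-(7 * t / 2)) = 1 / (Real.exp t ^ 3 * Real.exp (t / 2)) := by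
  rw [Real.exp_neg, show (7 : ℝ) * t / 2 = ((3 : ℕ) : ℝ) * t + t / 2 by push_cast; ring, Real.exp_add, Real.exp_nat_mul,
    one_div]

/-- `e^{(log y)/2} = √y` for `y > 0`. [cite: Feller1968, XIII.3] -/
private theorem exp_half_log_eo (hy : 0 < y) : Real.exp (Real.log y / 2) = Real.sqrt y := by
  have h : Real.exp (Real.log y / 2) ^ 2 = y := by rw [exp_half_sq_eo, Real.exp_log hy]
  rw [show Real.sqrt y = Real.sqrt (Real.exp (Real.log y / 2) ^ 2) by rw [h], Real.sqrt_sq (Real.exp_pos _).le]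

/-- `e^{2 log y} = y²` for `y > 0`. [cite: Feller1968, XIII.3] -/
private theorem exp_two_mul_log_eo (hy : 0 < y) : Real.exp (2 * Real.log y) = y ^ 2 := by
  rw [show (2 : ℝ) * Real.log y = ((2 : ℕ) : ℝ) * Real.log y by norm_num, Real.exp_nat_mul, Real.exp_log hy]

/-- From the deficit window: `m − 1 ≤ 4 m d` whenever `(m−1)/(4m) ≤ d` and `m > 0`. [cite: Feller1968, XIII.3] -/
private theorem sub_one_le_of_window_eo {m d : ℝ} (hm : 0 < m) (h : (m - 1) / (4 * m) ≤ d) : m - 1 ≤ 4 * m * d := by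
  rw [div_le_iff₀ (by positivity)] at h
  linarith

/-- From the deficit window: `2 m d ≤ m − 1` whenever `d ≤ (m−1)/(2m)` and `m > 0`. [cite: Feller1968, XIII.3] -/
private theorem le_sub_one_of_window_eo {m d : ℝ} (hm : 0 < m) (h : d ≤ (m - 1) / (2 * m)) : 2 * m * d ≤ m - 1 := by
  rw [le_div_iff₀ (by positivity)] at h
  linarith

/-! ### §2. The renewal excess through the density deficit, in the variable `t = log y` -/

/-- **UPPER, two terms (`t ≥ log 200`)**: `m(eᵗ) − 1 ≤ 4 m(eᵗ) (e^{−2t} + (3/2)e^{−3t} + 4275004 e^{−7t/2})` — the pool window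
`(m−1)/(4m) ≤ ½ − ρ⁻(t)` against the tree's `½ − ρ⁻(t) ≤ e^{−2t} + (3/2)e^{−3t} + 4275004 e^{−7t/2}`.
[cite: BeatonBousquetMelouDeGierDuminilCopinGuttmann2014, Section 3.1, Proposition 5 (arXiv v5 p. 9) and p. 10;
MadrasSlade1993, Section 4.2, Theorem 4.2.2 (pp. 91-92); Feller1968, XIII.3] -/
theorem pwbMean_exp_sub_one_le_two_terms (ht : Real.log 200 ≤ t) :
    pwbMean (Real.exp t) - 1 ≤ 4 * pwbMean (Real.exp t) *
      (Real.exp (-(2 * t)) + 3 / 2 * Real.exp (-(3 * t)) + 4275004 * Real.exp (-(7 * t / 2))) := by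
  have hμ := mu_four_lt_exp_eo ((Real.log_le_log (by norm_num) (by norm_num)).trans ht)
  exact sub_one_le_of_window_eo (pwbMean_pos hμ)
    ((le_half_sub_wallLeftDensity hμ).trans (half_sub_wallLeftDensity_le_two_terms ht))

/-- **LOWER, two terms (`t ≥ log 200`)**: `2 m(eᵗ) (e^{−2t} + (3/2)e^{−3t} − 950003 e^{−7t/2}) ≤ m(eᵗ) − 1` — the tree's
`e^{−2t} + (3/2)e^{−3t} − 950003 e^{−7t/2} ≤ ½ − ρ⁺(t)` against the pool window `½ − ρ⁺(t) ≤ (m−1)/(2m)`.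
[cite: BeatonBousquetMelouDeGierDuminilCopinGuttmann2014, Section 3.1, Proposition 5 (arXiv v5 p. 9) and p. 10;
MadrasSlade1993, Section 4.2, Theorem 4.2.2 (pp. 91-92); Feller1968, XIII.3] -/
theorem two_terms_le_pwbMean_exp_sub_one (ht : Real.log 200 ≤ t) :
    2 * pwbMean (Real.exp t) *
        (Real.exp (-(2 * t)) + 3 / 2 * Real.exp (-(3 * t)) - 950003 * Real.exp (-(7 * t / 2))) ≤
      pwbMean (Real.exp t) - 1 := by
  have hμ := mu_four_lt_exp_eo ((Real.log_le_log (by norm_num) (by norm_num)).trans ht)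
  exact le_sub_one_of_window_eo (pwbMean_pos hμ)
    ((half_sub_wallRightDensity_ge_two_terms ht).trans (half_sub_wallRightDensity_le hμ))

/-- **UPPER, first order (`t ≥ log 163`)**: `m(eᵗ) − 1 ≤ 4 m(eᵗ) (e^{−2t} + 52492 e^{−5t/2})`.
[cite: BeatonBousquetMelouDeGierDuminilCopinGuttmann2014, Section 3.1, Proposition 5 (arXiv v5 p. 9) and p. 10;
MadrasSlade1993, Section 4.2, Theorem 4.2.2 (pp. 91-92); Feller1968, XIII.3] -/
theorem pwbMean_exp_sub_one_le_coeff (ht : Real.log 163 ≤ t) :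
    pwbMean (Real.exp t) - 1 ≤ 4 * pwbMean (Real.exp t) * (Real.exp (-(2 * t)) + 52492 * Real.exp (-(5 * t / 2))) := by
  have hμ := mu_four_lt_exp_eo ht
  exact sub_one_le_of_window_eo (pwbMean_pos hμ)
    ((le_half_sub_wallLeftDensity hμ).trans (half_sub_wallLeftDensity_le_coeff ht))

/-- **LOWER, first order (`t ≥ log 163`)**: `2 m(eᵗ) (e^{−2t} − 21874 e^{−5t/2}) ≤ m(eᵗ) − 1`.
[cite: BeatonBousquetMelouDeGierDuminilCopinGuttmann2014, Section 3.1, Proposition 5 (arXiv v5 p. 9) and p. 10;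
MadrasSlade1993, Section 4.2, Theorem 4.2.2 (pp. 91-92); Feller1968, XIII.3] -/
theorem coeff_le_pwbMean_exp_sub_one (ht : Real.log 163 ≤ t) :
    2 * pwbMean (Real.exp t) * (Real.exp (-(2 * t)) - 21874 * Real.exp (-(5 * t / 2))) ≤ pwbMean (Real.exp t) - 1 := by
  have hμ := mu_four_lt_exp_eo ht
  exact le_sub_one_of_window_eo (pwbMean_pos hμ)
    ((half_sub_wallRightDensity_ge_coeff ht).trans (half_sub_wallRightDensity_le hμ))

/-- **SOLVED UPPER BOUND (`t ≥ log 163`)**: with `U(t) = e^{−2t} + 52492 e^{−5t/2}` (`4U < 1` there),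
`m(eᵗ) ≤ 1/(1 − 4 U(t))` — the renewal mean itself through the density deficit, no Kendall rate.
[cite: MadrasSlade1993, Section 4.2, Theorem 4.2.2 (pp. 91-92); Feller1968, XIII.3 and XIII.10;
BeatonBousquetMelouDeGierDuminilCopinGuttmann2014, Section 3.1, p. 10] -/
theorem pwbMean_exp_le_inv_one_sub (ht : Real.log 163 ≤ t) :
    pwbMean (Real.exp t) ≤ 1 / (1 - 4 * (Real.exp (-(2 * t)) + 52492 * Real.exp (-(5 * t / 2)))) := by
  have hμ := mu_four_lt_exp_eo ht
  have hm : 0 < pwbMean (Real.exp t) := pwbMean_pos hμ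
  have h := pwbMean_exp_sub_one_le_coeff ht
  have h163 : (163 : ℝ) ≤ Real.exp t := (Real.log_le_iff_le_exp (by norm_num)).1 ht
  set E := Real.exp t with hE
  have hs : 0 < Real.exp (t / 2) := Real.exp_pos _
  have hs12 : 12 ≤ Real.exp (t / 2) := by nlinarith [exp_half_sq_eo t]
  -- `4 U(t) ≤ 4/163² + 4·52492/(163²·12) < 1`
  have hU : 4 * (Real.exp (-(2 * t)) + 52492 * Real.exp (-(5 * t / 2))) < 1 := by
    rw [exp_neg_two_eo, exp_neg_five_halves_eo]
    have h1 : 1 / E ^ 2 ≤ 1 / 163 ^ 2 := by gcongr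
    have h2 : 1 / (E ^ 2 * Real.exp (t / 2)) ≤ 1 / (163 ^ 2 * 12) := by gcongr
    nlinarith
  rw [le_div_iff₀ (by linarith), mul_sub, mul_one]
  nlinarith

/-- **ASYMPTOTIC WINDOW in `t`**: for every `ε > 0`, eventually `2 − ε ≤ e^{2t} (m(eᵗ) − 1) ≤ 4 + ε` — the tree's
`e^{2t}(½ − ρ^±(t)) → 1` through the deficit window; in particular `m(eᵗ) → 1` at rate `e^{−2t}` with constants in `[2, 4]`.
[cite: BeatonBousquetMelouDeGierDuminilCopinGuttmann2014, Section 3.1, Proposition 5 (arXiv v5 p. 9) and p. 10;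
MadrasSlade1993, Section 4.2, Theorem 4.2.2 (pp. 91-92); Feller1968, XIII.3 and XIII.10] -/
theorem eventually_exp_two_mul_pwbMean_sub_one (hε : 0 < ε) :
    ∀ᶠ t : ℝ in atTop, 2 - ε ≤ Real.exp (2 * t) * (pwbMean (Real.exp t) - 1) ∧
      Real.exp (2 * t) * (pwbMean (Real.exp t) - 1) ≤ 4 + ε := by
  have hDp := tendsto_exp_mul_half_sub_wallRightDensity
  have hDm := tendsto_exp_mul_half_sub_wallLeftDensity
  have h2t : Tendsto (fun t : ℝ => 2 * t) atTop atTop := tendsto_id.const_mul_atTop (by norm_num)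
  have he : Tendsto (fun t : ℝ => Real.exp (-(2 * t))) atTop (𝓝 0) := Real.tendsto_exp_neg_atTop_nhds_zero.comp h2t
  -- `½ − ρ⁻(t) → 0`
  have h0 : Tendsto (fun t : ℝ => 1 / 2 - wallLeftDensity t) atTop (𝓝 0) := by
    have h := he.mul hDm
    rw [zero_mul] at h
    refine h.congr fun t => ?_
    show Real.exp (-(2 * t)) * (Real.exp (2 * t) * (1 / 2 - wallLeftDensity t)) = 1 / 2 - wallLeftDensity t
    rw [← mul_assoc, ← Real.exp_add, show -(2 * t) + 2 * t = 0 by ring, Real.exp_zero, one_mul]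
  -- the solved upper function `g(t) = 4 e^{2t}(½ − ρ⁻)/(1 − 4(½ − ρ⁻)) → 4`
  have hg : Tendsto (fun t : ℝ => 4 * (Real.exp (2 * t) * (1 / 2 - wallLeftDensity t)) /
      (1 - 4 * (1 / 2 - wallLeftDensity t))) atTop (𝓝 4) := by
    have hnum : Tendsto (fun t : ℝ => 4 * (Real.exp (2 * t) * (1 / 2 - wallLeftDensity t))) atTop (𝓝 (4 * 1)) :=
      hDm.const_mul 4
    have hden : Tendsto (fun t : ℝ => 1 - 4 * (1 / 2 - wallLeftDensity t)) atTop (𝓝 (1 - 4 * 0)) :=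
      tendsto_const_nhds.sub (h0.const_mul 4)
    have h := hnum.div hden (by norm_num : (1 : ℝ) - 4 * 0 ≠ 0)
    rw [show (4 : ℝ) * 1 / (1 - 4 * 0) = 4 by norm_num] at h
    exact h
  have hl : Tendsto (fun t : ℝ => 2 * (Real.exp (2 * t) * (1 / 2 - wallRightDensity t))) atTop (𝓝 2) := by
    simpa using hDp.const_mul 2
  filter_upwards [hg.eventually (eventually_le_nhds (by linarith : (4 : ℝ) < 4 + ε)),
    hl.eventually (eventually_ge_nhds (by linarith : (2 : ℝ) - ε < 2)),
    h0.eventually (eventually_lt_nhds (by norm_num : (0 : ℝ) < 1 / 8)), eventually_ge_atTop (Real.log 163)]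
    with t hgt hlt hdt ht
  have hμ := mu_four_lt_exp_eo ht
  have hm : 0 < pwbMean (Real.exp t) := pwbMean_pos hμ
  have hm1 : 1 ≤ pwbMean (Real.exp t) := one_le_pwbMean hμ
  have hE2 : 0 < Real.exp (2 * t) := Real.exp_pos _
  constructor
  · -- lower: `2 e^{2t}(½ − ρ⁺) ≤ 2 m e^{2t}(½ − ρ⁺) ≤ e^{2t}(m − 1)`
    have hw := le_sub_one_of_window_eo hm (half_sub_wallRightDensity_le hμ)
    have hd0 : 0 ≤ 1 / 2 - wallRightDensity t := by linarith [wallRightDensity_le_half t]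
    nlinarith [mul_nonneg (sub_nonneg.2 hm1) hd0]
  · -- upper: `m − 1 ≤ 4 m d`, `m ≤ 1/(1 − 4d)` ⇒ `e^{2t}(m−1) ≤ 4 e^{2t} d/(1 − 4d) = g(t) ≤ 4 + ε`
    have hw := sub_one_le_of_window_eo hm (le_half_sub_wallLeftDensity hμ)
    set d := 1 / 2 - wallLeftDensity t with hd
    have hd0 : 0 ≤ d := by have := wallLeftDensity_le_wallRightDensity t; linarith [wallRightDensity_le_half t]
    have h1d : 0 < 1 - 4 * d := by linarith
    have hmle : pwbMean (Real.exp t) * (1 - 4 * d) ≤ 1 := by nlinarith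
    have hkey : (pwbMean (Real.exp t) - 1) * (1 - 4 * d) ≤ 4 * d := by nlinarith
    have hkey' : Real.exp (2 * t) * (pwbMean (Real.exp t) - 1) ≤ 4 * (Real.exp (2 * t) * d) / (1 - 4 * d) := by
      rw [le_div_iff₀ h1d]
      nlinarith [hE2.le]
    exact hkey'.trans hgt

/-! ### §3. In the fugacity `y`: explicit windows and clean constants -/

/-- **TWO-SIDED WINDOW in `y` (`y ≥ 200`)**:
`2 m(y) (1/y² + 3/(2y³) − 950003/(y³√y)) ≤ m(y) − 1 ≤ 4 m(y) (1/y² + 3/(2y³) + 4275004/(y³√y))`.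
[cite: BeatonBousquetMelouDeGierDuminilCopinGuttmann2014, Section 3.1, Proposition 5 (arXiv v5 p. 9) and p. 10;
MadrasSlade1993, Section 4.2, Theorem 4.2.2 (pp. 91-92); Feller1968, XIII.3 and XIII.10] -/
theorem pwbMean_sub_one_window (hy : 200 ≤ y) :
    2 * pwbMean y * (1 / y ^ 2 + 3 / (2 * y ^ 3) - 950003 / (y ^ 3 * Real.sqrt y)) ≤ pwbMean y - 1 ∧
      pwbMean y - 1 ≤ 4 * pwbMean y * (1 / y ^ 2 + 3 / (2 * y ^ 3) + 4275004 / (y ^ 3 * Real.sqrt y)) := by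
  have hy0 : 0 < y := by linarith
  have ht : Real.log 200 ≤ Real.log y := Real.log_le_log (by norm_num) hy
  have hl := two_terms_le_pwbMean_exp_sub_one ht
  have hu := pwbMean_exp_sub_one_le_two_terms ht
  rw [exp_neg_two_eo, exp_neg_three_eo, exp_neg_seven_halves_eo, exp_half_log_eo hy0, Real.exp_log hy0] at hl hu
  constructor
  · convert hl using 2; ring
  · convert hu using 2; ring

/-- ★ **`1/y² ≤ m(y) − 1` for `y ≥ 20000`** (the lower window with `√y ≥ 141`; compare the pool's `1/(2y²)` for `y ≥ 230` and
`1/(5y² + 1)` for all `y > μ⁴`). [cite: MadrasSlade1993, Section 4.2, Theorem 4.2.2 (pp. 91-92); Feller1968, XIII.3 and XIII.10;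
BeatonBousquetMelouDeGierDuminilCopinGuttmann2014, Section 3.1, p. 10] -/
theorem one_div_sq_le_pwbMean_sub_one (hy : 20000 ≤ y) : 1 / y ^ 2 ≤ pwbMean y - 1 := by
  have hy0 : 0 < y := by linarith
  have hμ : hexConnectiveConstant ^ 4 < y := by linarith [mu_four_lt_sixteen_eo]
  have hm1 : 1 ≤ pwbMean y := one_le_pwbMean hμ
  have hl := (pwbMean_sub_one_window (by linarith : (200 : ℝ) ≤ y)).1
  have hs : 141 ≤ Real.sqrt y := Real.le_sqrt_of_sq_le (by nlinarith)
  have hs0 : 0 < Real.sqrt y := by linarith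
  -- `L(y) := 1/y² + 3/(2y³) − 950003/(y³√y) ≥ 1/(2y²)` since `950003/(y√y) ≤ 950003/(20000·141) < 1/2`
  have hL : 1 / (2 * y ^ 2) ≤ 1 / y ^ 2 + 3 / (2 * y ^ 3) - 950003 / (y ^ 3 * Real.sqrt y) := by
    have h1 : 950003 / (y ^ 3 * Real.sqrt y) ≤ 1 / (2 * y ^ 2) := by
      rw [div_le_div_iff₀ (by positivity) (by positivity)]
      have hys : 20000 * 141 ≤ y * Real.sqrt y := mul_le_mul hy hs (by norm_num) hy0.le
      have hy2 := mul_le_mul_of_nonneg_left hys (pow_pos hy0 2).le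
      have : 2820000 * y ^ 2 ≤ y ^ 3 * Real.sqrt y := by nlinarith [hy2]
      nlinarith [pow_pos hy0 2]
    have h2 : 0 ≤ 3 / (2 * y ^ 3) := by positivity
    have h3 : 1 / y ^ 2 = 1 / (2 * y ^ 2) + 1 / (2 * y ^ 2) := by ring
    linarith
  have hL0 : 0 ≤ 1 / y ^ 2 + 3 / (2 * y ^ 3) - 950003 / (y ^ 3 * Real.sqrt y) := hL.trans' (by positivity)
  calc 1 / y ^ 2 = 2 * 1 * (1 / (2 * y ^ 2)) := by ring
    _ ≤ 2 * pwbMean y * (1 / y ^ 2 + 3 / (2 * y ^ 3) - 950003 / (y ^ 3 * Real.sqrt y)) := by gcongr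
    _ ≤ pwbMean y - 1 := hl

/-- ★ **`m(y) − 1 ≤ 5/y²` for `y ≥ 100000`** (the upper window with `√y ≥ 316`, solved for `m − 1`; compare the pool's
`8749 (5 + 3 log y)/y²` for `y ≥ 100`). [cite: MadrasSlade1993, Section 4.2, Theorem 4.2.2 (pp. 91-92); Feller1968, XIII.3 and
XIII.10; BeatonBousquetMelouDeGierDuminilCopinGuttmann2014, Section 3.1, p. 10] -/
theorem pwbMean_sub_one_le_five_div_sq (hy : 100000 ≤ y) : pwbMean y - 1 ≤ 5 / y ^ 2 := by
  have hy0 : 0 < y := by linarith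
  have hμ : hexConnectiveConstant ^ 4 < y := by linarith [mu_four_lt_sixteen_eo]
  have hm1 : 1 ≤ pwbMean y := one_le_pwbMean hμ
  have hu := (pwbMean_sub_one_window (by linarith : (200 : ℝ) ≤ y)).2
  have hs : 316 ≤ Real.sqrt y := Real.le_sqrt_of_sq_le (by nlinarith)
  have hy2 : 0 < y ^ 2 := pow_pos hy0 2
  -- `u := 4 U(y)` satisfies `u y² ≤ 4.5416`
  set u := 4 * (1 / y ^ 2 + 3 / (2 * y ^ 3) + 4275004 / (y ^ 3 * Real.sqrt y)) with hu_def
  have hU1 : 4275004 / (y ^ 3 * Real.sqrt y) ≤ 13529 / y ^ 3 := by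
    rw [div_le_div_iff₀ (by positivity) (by positivity)]
    nlinarith [pow_pos hy0 3]
  have hU2 : 3 / (2 * y ^ 3) + 13529 / y ^ 3 ≤ 1354 / 10000 * (1 / y ^ 2) := by
    rw [div_add_div _ _ (by positivity) (by positivity), div_le_iff₀ (by positivity)]
    field_simp
    nlinarith [pow_pos hy0 3, pow_pos hy0 4]
  have huy : u * y ^ 2 ≤ 45416 / 10000 := by
    have : u ≤ 4 * ((1 + 1354 / 10000) * (1 / y ^ 2)) := by rw [hu_def]; nlinarith
    calc u * y ^ 2 ≤ 4 * ((1 + 1354 / 10000) * (1 / y ^ 2)) * y ^ 2 := by gcongr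
      _ = 45416 / 10000 := by field_simp; ring
  have hu0 : 0 ≤ u := by positivity
  have hu_small : u ≤ 1 / 2 := by
    have : u ≤ 45416 / 10000 / y ^ 2 := by rw [le_div_iff₀ hy2]; exact huy
    exact this.trans (by rw [div_le_iff₀ hy2]; nlinarith)
  -- `X := m − 1 ≤ u m` ⇒ `X (1 − u) ≤ u` ⇒ `X ≤ 2u`, and `X y² = X(1−u)y² + X u y² ≤ u y² + 2u · u y² ≤ 4.5416 (1 + 2u) ≤ 5`
  have hX : pwbMean y - 1 ≤ u * pwbMean y := by rw [hu_def]; nlinarith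
  have hX0 : 0 ≤ pwbMean y - 1 := by linarith
  have hX1 : (pwbMean y - 1) * (1 - u) ≤ u := by nlinarith
  have hX2 : pwbMean y - 1 ≤ 2 * u := by nlinarith
  rw [le_div_iff₀ hy2]
  have hW0 : 0 ≤ u * y ^ 2 := by positivity
  have hA : (pwbMean y - 1) * y ^ 2 ≤ u * y ^ 2 + (pwbMean y - 1) * (u * y ^ 2) := by
    nlinarith [mul_le_mul_of_nonneg_right hX1 hy2.le]
  have hB : (pwbMean y - 1) * (u * y ^ 2) ≤ 2 * u * (u * y ^ 2) := mul_le_mul_of_nonneg_right hX2 hW0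
  have hC : u * (u * y ^ 2) ≤ 45416 / 10000 * (45416 / 10000) / y ^ 2 := by
    rw [le_div_iff₀ hy2]
    nlinarith [mul_le_mul huy huy hW0 (by norm_num)]
  have hD : 45416 / 10000 * (45416 / 10000) / y ^ 2 ≤ (1 : ℝ) / 10000 := by
    rw [div_le_iff₀ hy2]
    nlinarith
  nlinarith [hA, hB, hC, hD, huy]

/-- **`m(y) → 1` at rate `y⁻²`, window form**: for every `ε > 0`, eventually `2 − ε ≤ y² (m(y) − 1) ≤ 4 + ε`.
[cite: BeatonBousquetMelouDeGierDuminilCopinGuttmann2014, Section 3.1, Proposition 5 (arXiv v5 p. 9) and p. 10;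
MadrasSlade1993, Section 4.2, Theorem 4.2.2 (pp. 91-92); Feller1968, XIII.3 and XIII.10] -/
theorem eventually_sq_mul_pwbMean_sub_one (hε : 0 < ε) :
    ∀ᶠ y : ℝ in atTop, 2 - ε ≤ y ^ 2 * (pwbMean y - 1) ∧ y ^ 2 * (pwbMean y - 1) ≤ 4 + ε := by
  filter_upwards [Real.tendsto_log_atTop.eventually (eventually_exp_two_mul_pwbMean_sub_one hε),
    eventually_gt_atTop 0] with y hy hy0
  rwa [exp_two_mul_log_eo hy0, Real.exp_log hy0] at hy

/-- ★★ **EXACT ORDER**: `(m(y) − 1) =Θ (1/y²)` as `y → ∞`. [cite: MadrasSlade1993, Section 4.2, Theorem 4.2.2 (pp. 91-92);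
Feller1968, XIII.3 and XIII.10; BeatonBousquetMelouDeGierDuminilCopinGuttmann2014, Section 3.1, p. 10] -/
theorem isTheta_pwbMean_sub_one : (fun y : ℝ => pwbMean y - 1) =Θ[atTop] fun y : ℝ => 1 / y ^ 2 := by
  have h := eventually_sq_mul_pwbMean_sub_one (by norm_num : (0 : ℝ) < 1)
  constructor
  · refine IsBigO.of_bound 5 ?_
    filter_upwards [h, eventually_gt_atTop 0] with y hy hy0
    have hy2 : 0 < y ^ 2 := pow_pos hy0 2
    have hnn : 0 ≤ pwbMean y - 1 := by nlinarith [hy.1]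
    rw [Real.norm_eq_abs, Real.norm_eq_abs, abs_of_nonneg hnn, abs_of_pos (by positivity), mul_one_div,
      le_div_iff₀ hy2]
    nlinarith [hy.2]
  · refine IsBigO.of_bound 1 ?_
    filter_upwards [h, eventually_gt_atTop 0] with y hy hy0
    have hy2 : 0 < y ^ 2 := pow_pos hy0 2
    have hnn : 0 ≤ pwbMean y - 1 := by nlinarith [hy.1]
    rw [Real.norm_eq_abs, Real.norm_eq_abs, abs_of_nonneg hnn, abs_of_pos (by positivity), one_mul,
      div_le_iff₀ hy2]
    nlinarith [hy.1]

/-- ★★ **EXACT ORDER in `t`**: `(m(eᵗ) − 1) =Θ (e^{−2t})` as `t → ∞` — the renewal excess and the density deficit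
(`½ − ρ^±(t) ~ e^{−2t}`, tree) are of the same order. [cite: MadrasSlade1993, Section 4.2, Theorem 4.2.2 (pp. 91-92);
Feller1968, XIII.3 and XIII.10; BeatonBousquetMelouDeGierDuminilCopinGuttmann2014, Section 3.1, p. 10] -/
theorem isTheta_pwbMean_exp_sub_one :
    (fun t : ℝ => pwbMean (Real.exp t) - 1) =Θ[atTop] fun t : ℝ => Real.exp (-(2 * t)) := by
  have h := eventually_exp_two_mul_pwbMean_sub_one (by norm_num : (0 : ℝ) < 1)
  have key : ∀ t : ℝ, Real.exp (-(2 * t)) * Real.exp (2 * t) = 1 := fun t => by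
    rw [← Real.exp_add, show -(2 * t) + 2 * t = 0 by ring, Real.exp_zero]
  constructor
  · refine IsBigO.of_bound 5 ?_
    filter_upwards [h] with t ht
    have hE : 0 < Real.exp (2 * t) := Real.exp_pos _
    have hnn : 0 ≤ pwbMean (Real.exp t) - 1 := by nlinarith [ht.1]
    rw [Real.norm_eq_abs, Real.norm_eq_abs, abs_of_nonneg hnn, abs_of_pos (Real.exp_pos _)]
    nlinarith [ht.2, key t, Real.exp_pos (-(2 * t))]
  · refine IsBigO.of_bound 1 ?_
    filter_upwards [h] with t ht
    have hE : 0 < Real.exp (2 * t) := Real.exp_pos _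
    have hnn : 0 ≤ pwbMean (Real.exp t) - 1 := by nlinarith [ht.1]
    rw [Real.norm_eq_abs, Real.norm_eq_abs, abs_of_nonneg hnn, abs_of_pos (Real.exp_pos _), one_mul]
    nlinarith [ht.1, key t, Real.exp_pos (-(2 * t))]

end Literature.Probability.RandomPlanarGeometry.SAW.HexBW.Wall
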